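import Summits.AtomisticToContinuum.BoseEinsteinCondensation.Theorems.GaussianDominationCan.Negative.LoadBearing
import Summits.AtomisticToContinuum.BoseEinsteinCondensation.Theorems.GaussianDominationCan.Negative.StructureII
import Summits.AtomisticToContinuum.BoseEinsteinCondensation.Theorems.BECThomsonPrincipleGaussianDominationCanThetaNorm
import Summits.AtomisticToContinuum.BoseEinsteinCondensation.Theorems.BECThomsonPrincipleGaussianDominationCanFreeCase
import HarnessLib

/-!
# Stub `stub_healingChord` (R2 "healing → anchor", line `raman-chord-regimes`, crux stmt-AtomisticToContinuum-9479)
# — worker analysis: where the proof stops, what IS provable (kernel-checked below), corner cases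

VERDICT: `stub-blocked` on the crux `…Theses.BECThomsonPrinciple.GaussianDominationCan` itself (crux-sized).
Not false (Bogoliubov gives it with `4π²C ≤ 2 + 0.05/K`), not mis-stated (no omitted hypothesis short of the
crux makes it provable), honest (no `toReal`/`⊤` loophole, §C).  R2 is not even implied by the crux (its
constants must be uniform over the truncation family `v_h = min(v,h)`).

## A. Where the card's mechanism (LSY one-mode c-number substitution + K1 + K2) stops  (A + B ≤ 60 lines)

A1. THE SUBSTITUTION PRICE IS NOT `h`-UNIFORM.  LSSY App. D = LSY 2005 for a mode `g ≠ 0`: the upper symbol of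
  `ε_g a_g†a_g` is `ε_g(|z|² − 1)`, so `δ(z)` of (D.4) carries `−ε_g = −k̃²` besides `2φ(N'+½)/V`
  (`φ = sup|ν̂_h| ≤ ∫v_h`, (D.9)); at `T = 0` (Berezin–Lieb (D.7) + (D.11)):
  `inf_z E₀(H'(z)) ≥ E₀(H) ≥ inf_z E₀(H'(z)) − k̃² − 2ρ∫v_h − O(∫v_h/L³)`  (sharp for a free mode).
  The chord's slack at the window bottom `s₁² = K k̃²ρ∫v_h` is `4π²(C − C_eff)·Kρ∫v_h`; the zero-point loss
  `k̃² ≤ M²ρ` fits only if `C ≥ M²/(4π²K∫v_h) → ∞` as `h → 0`.  Repairable (quantify `h ≥ h₀(v)`: the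
  truncation glue `gdIneq_of_trunc` only needs the `sup` over large `h`) — NOT the real obstruction, and the
  whole substitution is unnecessary (§B).
A2. K1 IS GAUSSIAN DOMINATION FOR THE BATH.  Normal-ordered `a_k ↦ z` and momentum conservation give
  `H'(z) = k̃²|z|² + H_bath + |z|²W₂ + (z̄²P + h.c.) + (z̄B + h.c.) + ν(0)|z|⁴/2L³`,
  `W₂ = L⁻³Σ_q (ν(0) + Re ν(q−k)) n_q ≥ 0`, `P = (2L³)⁻¹Σ_r ν(r) a_{k−r}a_{k+r}`,
  `B = L⁻³Σ_{q,r} ν(r) a†_{q−r} a_q a_{k−r} ∋ L⁻³ν(k) a†_{−k}a_0a_0 ≈ ρ₀ν̂_h(k)·a†_{−k}`: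
  the frozen mode drives the bath mode `−k` LINEARLY with strength `μ_k|z|`, `μ_k = ρν̂_h(k) ≤ ρ∫v_h`, and the
  `√N₀L⁻³Σ_rν(r)a_r a_{k−r}`-part of `B` renormalises `ν → 8πa`.  Completing squares,
  `κ = k̃² − μ_b + ρ(ν(0)+ν(k)) − μ_k²χ_B − (pair renormalisation)`, `χ_B` = static susceptibility of the bath
  (mode `k` frozen) to the source `a_{−k} + a†_{−k}`, `μ_b = ∂E₀/∂N ≤ ρ∫v_h`.  Bogoliubov: `χ_B = 1/(k̃²+μ)`
  exactly ⇒ `κ = k̃²(k̃²+2μ)/(k̃²+μ) ∈ [k̃², 2k̃²]`.  K1 (`κ ≥ ½k̃²` up to `O(ρ∫v_h)` additive) tolerates a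
  RELATIVE error on `χ_B` of at most `δ ≤ k̃²(k̃²+3μ)/(2μ²) ≈ 3(k̃ξ)²/2`: at the infrared end of the window
  (`k̃ = 2π/L`, `ρ ≤ ρ₀`, `L → ∞`) this is `T = 0` Gaussian domination for a linear one-mode source in the
  interacting gas to relative precision `(kξ)² → 0` — MORE than the crux asks (any constant `C`).  After
  `a_0 ↦ √N₀` the bath source `a_{−k} + h.c.` is the crux's `Λ_{−k} + Λ_{−k}†` up to the Josephson factor, so
  K1-IR ≡ crux-IR (cf. `Lines/ward-chord-splitting-dead.md` §3: twist states make every `√N`-renormalised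
  transfer meet the factor `1/x`).  Hard modes `k̃² ≥ K'ρ∫v_h`: a crude `χ_B ≤ K'²/(2k̃²)` would do, but "`χ_B ≤ c/k̃²`
  for SOME `c`" is again the crux (for mode `−k` of the bath; the crux allows any `C`), and `B` is not
  form-small w.r.t. `H_bath` with `N`-uniform constants (its one-condensate part has norm `~ μ N_ex/√N` on
  the bath ground state, `N_ex ~ N√(ρa³)`), so no Cauchy–Schwarz/Temple argument closes it; positivity
  `V ≥ 0` on `|tz⟩⊗Ψ` only yields `|⟨z̄B + h.c.⟩| ≤ ⟨V_bath⟩/t + t|z|²⟨W₂ + 2Re z̄²P/|z|² + …⟩`, i.e.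
  `~ 2|z|√(Nμ·ρ∫v_h)` after optimising `t` — useless below the anchor.  Naive operator stiffness `H − E₀ ≥ ck̃²n̂_{±k}` is FALSE at
  `Ψ₀` (depletion `n_k(Ψ₀) = v_k² > 0`).
A3. K2 (canonical Berezin–Lieb + number penalty) is bookkeeping `O(μ_b|z| + ∫v_h/L³)` and is NOT needed: §B.

## B. The clean equivalent, kernel-checked here: R2 ⟸ ONE-MODE SOFTENING (*)  (`healingChord_of_modeSoftening`)

The LNSS algebra performs the substitution exactly: `Λ_k†Λ_k = a_k†(a_0 n̂₀⁻¹ a_0†)a_k = n̂_k`, whence for every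
`ε > 0`, `2s|⟨Λ†⟩_Φ| ≤ 2s√⟨n̂_k⟩_Φ ≤ ε⟨n̂_k⟩_Φ + s²/ε` (Cauchy–Schwarz with the LANDED `stub_thetaNorm`,
`N‖Θ‖² ≤ 1`; in the crux's typing `⟨n̂_k⟩_Φ = N∫_{cell^N}|ĉ_k|²`, `ĉ_k = P₀(conj(e^{ik·x₀})Φ)` = `modeWeight`).
With `ε = ½k̃²`: GDIneq holds with `C = (2 + C″/K)/(4π²)` on the WHOLE half-line `s² ≥ Kk̃²ρ∫v_h` (the anchor
cap is not needed) as soon as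
  (*)  `E₀(v_h) + ½k̃²⟨n̂_k⟩_Φ ≤ E_{v_h}(Φ) + C″ρ∫v_h`  for all `Φ` (hypothesis `hsoft`, `h`-uniform),
i.e. "halving the dispersion of the ONE mode `k` lowers the ground-state energy by at most `C″` quanta `ρ∫v_h`"
— exactly the card's price "O(ρ∫v) per substituted mode", with no coherent states, no `k̃²` zero-point loss,
no number bookkeeping (Bogoliubov value: `E₀(H) − E₀(H − ½k̃²n̂_k) = μ_k·g(k̃²/μ_k)`, `max g ≈ 0.05`).
THIS IS WHERE THE PROOF STOPS: (*) at a near-minimiser gives `n_k(Ψ₀(v_h)) ≤ 2C″ρ∫v_h/k̃²`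
(`modeWeight_le_of_softening`), a `T = 0`
INFRARED BOUND on the momentum distribution of the interacting ground state, uniform as `L → ∞` at fixed `ρ`
(`n_{2π/L} ≤ C″ρ∫v·L²/2π²`; Bogoliubov `v_k²` sits inside with room).  Upper bounds on a single `n_k`,
`k ≠ 0`, at `T = 0`, uniform in the thermodynamic limit, exist in print ONLY through Gaussian domination + KLS
(reflection positivity: lattice, half filling — `Literature.Barriers…HalfFillingReflectionPositivity`); energy
methods give `Σ_k k²n_k ≤ E₀ ~ ½Nμ` (off by `N`) or depletion on sub-thermodynamic boxes
(`…KineticGapLengthScales`, `…EnergyAsymptoticsWithoutCondensation`).  Conversely R2 at `s₁` IS the secant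
susceptibility bound `(E₀ − E₀(s₁))/s₁² ≤ 4π²C/k̃²` at absolute resolution `O(ρ∫v_h)` — the same information.
So R2 = crux-strength (route-output strength ⊋ PeriodicBEC), uniformly in `h` on top.

## C. Corner cases (checked; two are theorems below)
* `v = 0` (more generally `∫v_h = 0 = E₀(v_h)`): both regime bounds force `s = 0`; R2 holds TRIVIALLY
  (`healingChord_zero`, certified against the registered signature at `v = 0`) — it does not even "reduce to
  the free chord".
* Hard cores (`∫v = ⊤`): `∫v_h ≍ h|B_{R₀}|`, `E₀(v_h) ≤ E₀(v) ≈ 4πR₀ρN`: the window is empty iff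
  `h ≳ 3N/(KR₀²)` — a condition per `(N, L)`, not per `h`: for EVERY fixed `h` all `N ≥ hKR₀²/3` (admissible:
  `N₀ ≤ N ≤ ρ₀L³`, `L` free) have a non-empty window.  R2 is never vacuous in `h`; its hard-core content is real.
* `toReal`s honest: `∫⁻min(v,h) ≤ h·|B_{R₀}| < ⊤` (finite range), `E₀(v_h) ≤ E_{v_h}(const) < ⊤` (`v_h^per`
  bounded on the cell).  Window non-empty iff `Kρ∫v_h ≤ E₀(v_h) (≤ ½ρ(N−1)∫v_h)`: for every `h`, all large `N`.

## D. Restrictions that ARE provable — none of them is R2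
(i) the near-anchor band `k̃²E₀(v_h) ≤ K₂s²` (`K₂ ≥ 1`): FREE from the landed free chord by chord
  interpolation (`gdIneq_interp` + the planner's `anchorChord` ⇒ `anchorBand_holds`, constant `√K₂/(2π²)`): it
  lowers the anchor by a constant factor and hands `[Kk̃²ρ∫v_h, k̃²E₀/K₂]` to R1 = the crux; (ii) `h ≥ h₀`:
  harmless, does not touch (*); (iii) hard modes `k̃² ≥ K'ρ∫v_h`: still needs "`χ_B ≤ c/k̃²`" (A2) / (*);
  (iv) GP boxes `L√(ρa) ≤ C_L`: outside the crux's quantifier domain (all `L` at `ρ ≤ ρ₀`), and even there needs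
  BBCS-type Bogoliubov theory for a two-mode coherent condensate (not in tree).
Facts one would vendor for the card's route (none removes (*)): LSSY App. D (D.4)/(D.9)/(D.11) at `T = 0` for a
general mode [LSY 2005, doi:10.1103/PhysRevLett.94.080401]: "for `H = Σε_p a_p†a_p + (2V)⁻¹Σν(p)a†a†aa` on Fock
space, `|ν| ≤ φ`: `inf_z inf spec H'(z) ≥ inf spec H ≥ inf_z inf spec(H'(z) − ε_g − 2φ(N'+½)/V)`"; Berezin–Lieb
[doi:10.1007/BF01646493]: `inf spec H ≥ inf_z (upper symbol)`.  Both need second quantisation on the torus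
(Fock space, `a_p`, `ν̂`) — absent from the tree's first-quantised `C¹` vocabulary; size XL to state
faithfully, and by §B unnecessary.
-/

noncomputable section

namespace Summit.AtomisticToContinuum.BoseEinsteinCondensation.Cruxes.GaussianDominationCan.RamanChordRegimes

namespace HealingChord

open MeasureTheory
open scoped ENNReal NNReal ComplexConjugate
open Literature.MathematicalPhysics.QuantumManyBody.BoseGas
open Summit.AtomisticToContinuum.BoseEinsteinCondensation.Theorems.GaussianDominationCan.Negative
open Summit.AtomisticToContinuum.BoseEinsteinCondensation.Cruxes.GaussianDominationCan.CouplingMonotoneChord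
  (stub_freeCase stub_thetaNorm)

variable {L : ℝ}

/-! ## §1 Chord interpolation: the top of R2's window is soft by any constant factor -/

/-- **Chord interpolation** (convexity of `s ↦ E₀ − E₀(s)` at the level of one trial state): a chord at
`s₀` with constant `C₀` gives the chord at every `0 ≤ s ≤ s₀` with any constant `C` such that
`C₀ s₀ ≤ C s` — `2sb ≤ (s/s₀)(e − a + c₀s₀²) ≤ (e − a) + c₀ s s₀`. [folklore] -/
theorem gdIneq_interp {w : ℝ → ℝ≥0∞} {m : ℕ} {n : Fin 3 → ℤ} {C₀ C s₀ s : ℝ}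
    {Φ : PeriodicTrialState (m + 1) L} (hs : 0 ≤ s) (hss₀ : s ≤ s₀) (hC₀ : 0 ≤ C₀)
    (hCs : C₀ * s₀ ≤ C * s) (h₀ : GDIneq w m L n C₀ s₀ Φ) : GDIneq w m L n C s Φ := by
  rcases hs.eq_or_lt with h0 | hspos
  · exact gdIneq_of_nonpos (le_of_eq h0.symm) Φ
  have hs₀ : 0 < s₀ := lt_of_lt_of_le hspos hss₀
  have hC : 0 ≤ C := by
    have : 0 ≤ C * s := le_trans (mul_nonneg hC₀ hs₀.le) hCs
    exact nonneg_of_mul_nonneg_left this hspos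
  unfold GDIneq at h₀ ⊢
  by_cases htop : periodicEnergy w Φ = ⊤
  · rw [htop, top_add]
    exact le_top
  have hE0le : periodicGroundStateEnergy w (m + 1) L ≤ periodicEnergy w Φ :=
    periodicGroundStateEnergy_le w Φ
  have hE0top : periodicGroundStateEnergy w (m + 1) L ≠ ⊤ := ne_top_of_le_ne_top htop hE0le
  set a : ℝ := (periodicGroundStateEnergy w (m + 1) L).toReal with ha
  set e : ℝ := (periodicEnergy w Φ).toReal with he
  set B : ℝ := 2 * (m + 1) * ‖sourceIntegral m L n Φ.ψ‖ with hB
  set q : ℝ := L ^ 2 / ‖(fun j => (n j : ℝ))‖ ^ 2 with hq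
  have hB0 : 0 ≤ B := by positivity
  have hq0 : 0 ≤ q := by positivity
  have hae : a ≤ e := ENNReal.toReal_mono htop hE0le
  have hpen₀ : 0 ≤ C₀ * s₀ ^ 2 * L ^ 2 / ‖(fun j => (n j : ℝ))‖ ^ 2 := by positivity
  have hpen : 0 ≤ C * s ^ 2 * L ^ 2 / ‖(fun j => (n j : ℝ))‖ ^ 2 := by positivity
  rw [← ENNReal.ofReal_toReal hE0top, ← ENNReal.ofReal_toReal htop] at h₀ ⊢
  rw [← ENNReal.ofReal_add ENNReal.toReal_nonneg (mul_nonneg hs₀.le hB0),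
    ← ENNReal.ofReal_add ENNReal.toReal_nonneg hpen₀,
    ENNReal.ofReal_le_ofReal_iff (add_nonneg ENNReal.toReal_nonneg hpen₀)] at h₀
  rw [← ENNReal.ofReal_add ENNReal.toReal_nonneg (mul_nonneg hs hB0),
    ← ENNReal.ofReal_add ENNReal.toReal_nonneg hpen,
    ENNReal.ofReal_le_ofReal_iff (add_nonneg ENNReal.toReal_nonneg hpen)]
  change a + s₀ * B ≤ e + C₀ * s₀ ^ 2 * L ^ 2 / ‖(fun j => (n j : ℝ))‖ ^ 2 at h₀
  change a + s * B ≤ e + C * s ^ 2 * L ^ 2 / ‖(fun j => (n j : ℝ))‖ ^ 2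
  have e₀ : C₀ * s₀ ^ 2 * L ^ 2 / ‖(fun j => (n j : ℝ))‖ ^ 2 = C₀ * s₀ ^ 2 * q := by
    rw [hq]; ring
  have e₁ : C * s ^ 2 * L ^ 2 / ‖(fun j => (n j : ℝ))‖ ^ 2 = C * s ^ 2 * q := by
    rw [hq]; ring
  rw [e₀] at h₀
  rw [e₁]
  have h1 : s * (s₀ * B) ≤ s * (e - a + C₀ * s₀ ^ 2 * q) :=
    mul_le_mul_of_nonneg_left (by linarith) hs
  have h2 : s * (e - a) ≤ s₀ * (e - a) := mul_le_mul_of_nonneg_right hss₀ (sub_nonneg.mpr hae)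
  have h3 : C₀ * s₀ * (s₀ * s * q) ≤ C * s * (s₀ * s * q) :=
    mul_le_mul_of_nonneg_right hCs (mul_nonneg (mul_nonneg hs₀.le hs) hq0)
  have h4 : s₀ * (a + s * B) ≤ s₀ * (e + C * s ^ 2 * q) := by nlinarith [h1, h2, h3]
  exact le_of_mul_le_mul_left h4 hs₀

/-! ## §2 The planner's glue, copied verbatim from the skeleton (`Lines/raman-chord-regimes.lean`) -/

/-- `v ↦ v^per` is monotone. [folklore] (planner's `periodizedPotential_mono`) -/
theorem periodizedPotential_mono {w₁ w₂ : ℝ → ℝ≥0∞} (hw : ∀ r, w₁ r ≤ w₂ r) (L : ℝ) (x : Space) :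
    periodizedPotential w₁ L x ≤ periodizedPotential w₂ L x := by
  unfold periodizedPotential
  exact ENNReal.tsum_le_tsum fun _ => hw _

/-- `v ↦ ∑_{i<j} v^per(xᵢ - xⱼ)` is monotone. [folklore] (planner's `periodicInteraction_mono`) -/
theorem periodicInteraction_mono {N : ℕ} {w₁ w₂ : ℝ → ℝ≥0∞} (hw : ∀ r, w₁ r ≤ w₂ r) (L : ℝ)
    (X : Config N) : periodicInteraction w₁ L X ≤ periodicInteraction w₂ L X := by
  unfold periodicInteraction
  exact Finset.sum_le_sum fun i _ => Finset.sum_le_sum fun j _ => periodizedPotential_mono hw L _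

/-- `v ↦ E_v(Ψ)` is monotone. [folklore] (planner's `periodicEnergy_mono`) -/
theorem periodicEnergy_mono {N : ℕ} {L : ℝ} {w₁ w₂ : ℝ → ℝ≥0∞} (hw : ∀ r, w₁ r ≤ w₂ r)
    (Ψ : PeriodicTrialState N L) : periodicEnergy w₁ Ψ ≤ periodicEnergy w₂ Ψ := by
  unfold periodicEnergy
  exact lintegral_mono fun X =>
    add_le_add le_rfl (mul_le_mul' (periodicInteraction_mono hw L X) le_rfl)

/-- **R3, the free anchor** (planner's `anchorChord`, verbatim): for EVERY potential `w ≥ 0` the chord holds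
with constant `1/(2π²)` once `s² ≥ k̃² E₀(w)`. [folklore] -/
theorem anchorChord
    (hfree : ∀ m : ℕ, ∀ L : ℝ, 0 < L → ∀ n : Fin 3 → ℤ, n ≠ 0 → ∀ s : ℝ, 0 ≤ s →
      ∀ Φ : PeriodicTrialState (m + 1) L, GDIneq 0 m L n (1 / (4 * Real.pi ^ 2)) s Φ)
    (w : ℝ → ℝ≥0∞) (m : ℕ) {L : ℝ} (hL : 0 < L) {n : Fin 3 → ℤ} (hn : n ≠ 0) {s : ℝ}
    (hs : 0 ≤ s)
    (hs2 : (2 * Real.pi * ‖(fun j => (n j : ℝ))‖ / L) ^ 2 *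
        (periodicGroundStateEnergy w (m + 1) L).toReal ≤ s ^ 2)
    (Φ : PeriodicTrialState (m + 1) L) : GDIneq w m L n (1 / (2 * Real.pi ^ 2)) s Φ := by
  unfold GDIneq
  by_cases htop : periodicGroundStateEnergy w (m + 1) L = ⊤
  · have hE : periodicEnergy w Φ = ⊤ :=
      eq_top_iff.mpr (htop ▸ periodicGroundStateEnergy_le w Φ)
    rw [hE, top_add]
    exact le_top
  have hfreeΦ := hfree m L hL n hn s hs Φ
  unfold GDIneq at hfreeΦ
  have hA : ENNReal.ofReal (s * (2 * (m + 1) * ‖sourceIntegral m L n Φ.ψ‖)) ≤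
      periodicEnergy 0 Φ +
        ENNReal.ofReal (1 / (4 * Real.pi ^ 2) * s ^ 2 * L ^ 2 / ‖(fun j => (n j : ℝ))‖ ^ 2) :=
    le_trans le_add_self hfreeΦ
  have hE0w : periodicEnergy 0 Φ ≤ periodicEnergy w Φ := periodicEnergy_mono (fun r => bot_le) Φ
  have hnorm : 0 < ‖(fun j => (n j : ℝ))‖ := lt_of_lt_of_le one_pos (one_le_norm_intVec hn)
  have hpen : 0 ≤ 1 / (4 * Real.pi ^ 2) * s ^ 2 * L ^ 2 / ‖(fun j => (n j : ℝ))‖ ^ 2 := by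
    positivity
  have hE0 : periodicGroundStateEnergy w (m + 1) L ≤
      ENNReal.ofReal (1 / (4 * Real.pi ^ 2) * s ^ 2 * L ^ 2 / ‖(fun j => (n j : ℝ))‖ ^ 2) := by
    rw [← ENNReal.ofReal_toReal htop]
    apply ENNReal.ofReal_le_ofReal
    set E : ℝ := (periodicGroundStateEnergy w (m + 1) L).toReal with hEdef
    have hk : (2 * Real.pi * ‖(fun j => (n j : ℝ))‖ / L) ^ 2 =
        4 * Real.pi ^ 2 * ‖(fun j => (n j : ℝ))‖ ^ 2 / L ^ 2 := by ring
    rw [hk, div_mul_eq_mul_div, div_le_iff₀ (by positivity)] at hs2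
    rw [le_div_iff₀ (by positivity)]
    have h4 : (0 : ℝ) < 4 * Real.pi ^ 2 := by positivity
    calc E * ‖(fun j => (n j : ℝ))‖ ^ 2
        = (4 * Real.pi ^ 2 * ‖(fun j => (n j : ℝ))‖ ^ 2 * E) / (4 * Real.pi ^ 2) := by
          rw [eq_div_iff h4.ne']
          ring
      _ ≤ (s ^ 2 * L ^ 2) / (4 * Real.pi ^ 2) := div_le_div_of_nonneg_right hs2 h4.le
      _ = 1 / (4 * Real.pi ^ 2) * s ^ 2 * L ^ 2 := by ring
  calc periodicGroundStateEnergy w (m + 1) L +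
        ENNReal.ofReal (s * (2 * (m + 1) * ‖sourceIntegral m L n Φ.ψ‖))
      ≤ ENNReal.ofReal (1 / (4 * Real.pi ^ 2) * s ^ 2 * L ^ 2 / ‖(fun j => (n j : ℝ))‖ ^ 2) +
          (periodicEnergy 0 Φ +
            ENNReal.ofReal (1 / (4 * Real.pi ^ 2) * s ^ 2 * L ^ 2 / ‖(fun j => (n j : ℝ))‖ ^ 2)) :=
        add_le_add hE0 hA
    _ ≤ ENNReal.ofReal (1 / (4 * Real.pi ^ 2) * s ^ 2 * L ^ 2 / ‖(fun j => (n j : ℝ))‖ ^ 2) +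
          (periodicEnergy w Φ +
            ENNReal.ofReal (1 / (4 * Real.pi ^ 2) * s ^ 2 * L ^ 2 / ‖(fun j => (n j : ℝ))‖ ^ 2)) :=
        add_le_add le_rfl (add_le_add hE0w le_rfl)
    _ = periodicEnergy w Φ +
          (ENNReal.ofReal (1 / (4 * Real.pi ^ 2) * s ^ 2 * L ^ 2 / ‖(fun j => (n j : ℝ))‖ ^ 2) +
            ENNReal.ofReal (1 / (4 * Real.pi ^ 2) * s ^ 2 * L ^ 2 / ‖(fun j => (n j : ℝ))‖ ^ 2)) := by
        rw [add_left_comm]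
    _ = periodicEnergy w Φ +
          ENNReal.ofReal (1 / (2 * Real.pi ^ 2) * s ^ 2 * L ^ 2 / ‖(fun j => (n j : ℝ))‖ ^ 2) := by
        rw [← ENNReal.ofReal_add hpen hpen]
        congr 2
        ring

/-! ## §3 The near-anchor band is free (D(i)): `k̃²E₀(w) ≤ K₂ s²` ⇒ chord with constant `√K₂/(2π²)` -/

/-- **Near-anchor band** from the free chord: for every potential `w ≥ 0`, every `K₂ ≥ 1` and every
`s ≥ 0` with `k̃² E₀(w) ≤ K₂ s²` the chord holds with constant `√K₂/(2π²)` — the anchor at `s₀ = √K₂·s`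
interpolated down to `s` (`gdIneq_interp`).  So R2's upper threshold may be lowered by any constant factor for
free; only its bottom `s² ≍ K k̃²ρ∫v_h` carries content. [folklore] -/
theorem anchorBand
    (hfree : ∀ m : ℕ, ∀ L : ℝ, 0 < L → ∀ n : Fin 3 → ℤ, n ≠ 0 → ∀ s : ℝ, 0 ≤ s →
      ∀ Φ : PeriodicTrialState (m + 1) L, GDIneq 0 m L n (1 / (4 * Real.pi ^ 2)) s Φ)
    (w : ℝ → ℝ≥0∞) (m : ℕ) {L : ℝ} (hL : 0 < L) {n : Fin 3 → ℤ} (hn : n ≠ 0) {s : ℝ}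
    (hs : 0 ≤ s) {K₂ : ℝ} (hK₂ : 1 ≤ K₂)
    (hs2 : (2 * Real.pi * ‖(fun j => (n j : ℝ))‖ / L) ^ 2 *
        (periodicGroundStateEnergy w (m + 1) L).toReal ≤ K₂ * s ^ 2)
    (Φ : PeriodicTrialState (m + 1) L) :
    GDIneq w m L n (Real.sqrt K₂ / (2 * Real.pi ^ 2)) s Φ := by
  have hK₀ : 0 ≤ K₂ := le_trans zero_le_one hK₂
  have h1 : 1 ≤ Real.sqrt K₂ := by
    rw [← Real.sqrt_one]
    exact Real.sqrt_le_sqrt hK₂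
  set s₀ : ℝ := Real.sqrt K₂ * s with hs₀def
  have hs₀ : 0 ≤ s₀ := mul_nonneg (Real.sqrt_nonneg _) hs
  have hs₀2 : (2 * Real.pi * ‖(fun j => (n j : ℝ))‖ / L) ^ 2 *
      (periodicGroundStateEnergy w (m + 1) L).toReal ≤ s₀ ^ 2 := by
    rw [hs₀def, mul_pow, Real.sq_sqrt hK₀]
    exact hs2
  have hA := anchorChord hfree w m hL hn hs₀ hs₀2 Φ
  refine gdIneq_interp hs (le_mul_of_one_le_left hs h1) (by positivity) (le_of_eq ?_) hA
  ring

/-- The near-anchor band, unconditionally (the free chord is the LANDED `stub_freeCase` of the sibling line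
`coupling-monotone-chord`). [folklore] -/
theorem anchorBand_holds (w : ℝ → ℝ≥0∞) (m : ℕ) {L : ℝ} (hL : 0 < L) {n : Fin 3 → ℤ} (hn : n ≠ 0)
    {s : ℝ} (hs : 0 ≤ s) {K₂ : ℝ} (hK₂ : 1 ≤ K₂)
    (hs2 : (2 * Real.pi * ‖(fun j => (n j : ℝ))‖ / L) ^ 2 *
        (periodicGroundStateEnergy w (m + 1) L).toReal ≤ K₂ * s ^ 2)
    (Φ : PeriodicTrialState (m + 1) L) :
    GDIneq w m L n (Real.sqrt K₂ / (2 * Real.pi ^ 2)) s Φ :=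
  anchorBand stub_freeCase w m hL hn hs hK₂ hs2 Φ

/-! ## §4 Corner case `v = 0`: R2 is trivial (both regime bounds force `s = 0`) -/

/-- The free periodic ground-state energy vanishes (constant state). [folklore] -/
theorem periodicGroundStateEnergy_zero_pot {L : ℝ} (hL : 0 < L) (m : ℕ) :
    periodicGroundStateEnergy 0 (m + 1) L = 0 := by
  have hc : ((Real.sqrt (L ^ 3))⁻¹) ^ 2 * L ^ 3 = 1 := by
    rw [inv_pow, Real.sq_sqrt (by positivity)]
    exact inv_mul_cancel₀ (by positivity)
  exact le_antisymm ((periodicGroundStateEnergy_le 0 (constState m hL _ hc)).trans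
    (periodicEnergy_constState hL hc).le) zero_le

/-- **`v = 0`: the stub's body holds trivially** — `min(0,h) = 0`, `E₀(0) = 0`, so the upper regime bound
reads `s² ≤ 0`, i.e. `s = 0`, where the chord is the variational principle (the body of `stub_healingChord`
at `v = 0`, verbatim, with `ρ₀ = C = 1`, `N₀ = 0`). [folklore] -/
theorem healingChord_zero :
    ∀ M : ℝ, 0 < M → ∀ K : ℝ, 0 < K →
      ∃ ρ₀ C : ℝ, 0 < ρ₀ ∧ 0 < C ∧ ∃ N₀ : ℕ, ∀ h : ℝ, 0 < h →
        ∀ m : ℕ, N₀ ≤ m + 1 → ∀ L : ℝ, 0 < L → ((m + 1 : ℕ) : ℝ) ≤ ρ₀ * L ^ 3 →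
        ∀ n : Fin 3 → ℤ, n ≠ 0 → InWindow M m L n → ∀ s : ℝ, 0 ≤ s →
          K * ((2 * Real.pi * ‖(fun j => (n j : ℝ))‖ / L) ^ 2 *
            (((m + 1 : ℕ) : ℝ) / L ^ 3) *
              (∫⁻ x : Space, min ((0 : ℝ → ℝ≥0∞) ‖x‖) (ENNReal.ofReal h)).toReal) ≤ s ^ 2 →
          s ^ 2 ≤ (2 * Real.pi * ‖(fun j => (n j : ℝ))‖ / L) ^ 2 *
            (periodicGroundStateEnergy (fun r => min ((0 : ℝ → ℝ≥0∞) r) (ENNReal.ofReal h))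
              (m + 1) L).toReal →
          ∀ Φ : PeriodicTrialState (m + 1) L,
            GDIneq (fun r => min ((0 : ℝ → ℝ≥0∞) r) (ENNReal.ofReal h)) m L n C s Φ := by
  intro M _ K _
  refine ⟨1, 1, one_pos, one_pos, 0, ?_⟩
  intro h _ m _ L hL _ n _ _ s hs _ h2 Φ
  have hv : (fun r => min ((0 : ℝ → ℝ≥0∞) r) (ENNReal.ofReal h)) = 0 := by
    funext r
    simp
  rw [hv] at h2 ⊢
  rw [periodicGroundStateEnergy_zero_pot hL m, ENNReal.toReal_zero, mul_zero] at h2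
  have hs0 : s = 0 := by nlinarith [sq_nonneg s]
  exact gdIneq_of_nonpos (le_of_eq hs0) Φ

/-! ## §5 The reduction of B: R2 ⟸ one-mode softening (*) — no c-numbers, no Berezin–Lieb -/

section Reduction

/-! ### Helpers (adapted from the landed `…GaussianDominationCanFreeAnchorOf.lean`, where they are private) -/

-- adapted from Theorems/BECThomsonPrincipleGaussianDominationCanFreeAnchorOf.lean (private there)
/-- The crux's phase `e^{ik·x₀}` is continuous on configuration space. [folklore] -/
private theorem continuous_phase' (m : ℕ) (L : ℝ) (n : Fin 3 → ℤ) : Continuous (phase m L n) := by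
  have h : phase m L n = fun X => cellWave L n (X 0) := funext (phase_eq_cellWave m L n)
  rw [h]
  exact (contDiff_cellWave L n).continuous.comp (continuous_apply 0)

-- adapted from Theorems/BECThomsonPrincipleGaussianDominationCanFreeAnchorOf.lean (private there)
/-- The crux's `foldr` of cell averages / fluctuations preserves continuity. [folklore] -/
private theorem continuous_foldr_cellAvg {N : ℕ} {L : ℝ} (S : Finset (Fin N)) {g : Config N → ℂ}
    (hg : Continuous g) (l : List (Fin N)) :
    Continuous (l.foldr (fun i h => if i ∈ S then cellAvg N L i h else h - cellAvg N L i h) g) := by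
  induction l with
  | nil => exact hg
  | cons a l ih =>
    rw [List.foldr_cons]
    split_ifs
    · exact continuous_cellAvg a ih
    · exact ih.sub (continuous_cellAvg a ih)

-- adapted from Theorems/BECThomsonPrincipleGaussianDominationCanFreeAnchorOf.lean (private there)
/-- `Θ = Σ_{S∋0} |S|^{-1/2} Q_S ψ` is continuous for continuous `ψ`. [folklore] -/
private theorem continuous_theta' (m : ℕ) (L : ℝ) {ψ : Config (m + 1) → ℂ} (hψ : Continuous ψ) :
    Continuous (theta m L ψ) := by
  unfold theta
  exact continuous_finsetSum _ fun S _ =>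
    continuous_const.mul (continuous_foldr_cellAvg S hψ _)

-- adapted from Theorems/BECThomsonPrincipleGaussianDominationCanFreeAnchorOf.lean (private there)
/-- `P₀ Θ = Θ`: `Θ` does not depend on `x₀` and `∫_cell 1 = L³`. [folklore] -/
private theorem cellAvg_zero_theta {m : ℕ} {L : ℝ} (hL : 0 < L) (ψ : Config (m + 1) → ℂ) :
    cellAvg (m + 1) L 0 (theta m L ψ) = theta m L ψ := by
  funext X
  show ((L ^ 3)⁻¹ : ℝ) • ∫ y in cell L, theta m L ψ (Function.update X 0 y) = _
  simp_rw [theta_update_zero]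
  rw [integral_cell_const hL, Complex.real_smul, ← mul_assoc]
  have hL' : (L : ℂ) ≠ 0 := by exact_mod_cast hL.ne'
  rw [show (((L ^ 3)⁻¹ : ℝ) : ℂ) * (L : ℂ) ^ 3 = 1 by
    rw [Complex.ofReal_inv, Complex.ofReal_pow, inv_mul_cancel₀ (pow_ne_zero 3 hL')], one_mul]

-- adapted from Theorems/BECThomsonPrincipleGaussianDominationCanFreeAnchorOf.lean (private there)
/-- **The source through the mode coefficient**: `I(ψ) = ∫ conj(ĉ_k)·Θ` with
`ĉ_k = P₀(conj(e^{ik·x₀}) ψ)` (self-adjointness of `P₀` and `P₀Θ = Θ`). [folklore] -/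
private theorem sourceIntegral_eq_integral_conj_modeCoeff {m : ℕ} {L : ℝ} (hL : 0 < L)
    (n : Fin 3 → ℤ) {ψ : Config (m + 1) → ℂ} (hψ : Continuous ψ) :
    sourceIntegral m L n ψ =
      ∫ X in cellN (m + 1) L,
        conj (cellAvg (m + 1) L 0 (fun Y => conj (phase m L n Y) * ψ Y) X) * theta m L ψ X := by
  have hg : Continuous fun Y => conj (phase m L n Y) * ψ Y :=
    (Complex.continuous_conj.comp (continuous_phase' m L n)).mul hψ
  rw [← integral_conj_mul_cellAvg 0 hg (continuous_theta' m L hψ), cellAvg_zero_theta hL]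
  unfold sourceIntegral
  refine integral_congr_ae (Filter.Eventually.of_forall fun X => ?_)
  show conj (ψ X) * phase m L n X * theta m L ψ X =
    conj (conj (phase m L n X) * ψ X) * theta m L ψ X
  rw [map_mul, Complex.conj_conj]
  ring

-- adapted from Theorems/BECThomsonPrincipleGaussianDominationCanFreeAnchorOf.lean (private there)
/-- **Cauchy–Schwarz** on `cell^N` in `ℝ≥0∞`: `‖∫ conj(f)·g‖² ≤ (∫|f|²)(∫|g|²)` for continuous
`f`, `g`. [folklore] -/
private theorem enorm_integral_conj_mul_sq_le {N : ℕ} {L : ℝ} {f g : Config N → ℂ}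
    (hf : Continuous f) (hg : Continuous g) :
    ‖∫ X in cellN N L, conj (f X) * g X‖ₑ ^ 2 ≤
      (∫⁻ X in cellN N L, (‖f X‖₊ : ℝ≥0∞) ^ 2) * ∫⁻ X in cellN N L, (‖g X‖₊ : ℝ≥0∞) ^ 2 := by
  set μ : Measure (Config N) := (volume : Measure (Config N)).restrict (cellN N L)
  have h1 : ‖∫ X, conj (f X) * g X ∂μ‖ₑ ≤ ∫⁻ X, ‖f X‖ₑ * ‖g X‖ₑ ∂μ := by
    refine (enorm_integral_le_lintegral_enorm _).trans (lintegral_mono fun X => ?_)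
    rw [enorm_mul, RCLike.enorm_conj]
  have h2 : ∫⁻ X, ‖f X‖ₑ * ‖g X‖ₑ ∂μ ≤
      (∫⁻ X, ‖f X‖ₑ ^ 2 ∂μ) ^ (1 / 2 : ℝ) * (∫⁻ X, ‖g X‖ₑ ^ 2 ∂μ) ^ (1 / 2 : ℝ) := by
    have h := ENNReal.lintegral_mul_le_Lp_mul_Lq μ Real.HolderConjugate.two_two
      hf.aestronglyMeasurable.enorm hg.aestronglyMeasurable.enorm
    simpa only [Pi.mul_apply, ENNReal.rpow_two, one_div] using h
  calc ‖∫ X, conj (f X) * g X ∂μ‖ₑ ^ 2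
      ≤ ((∫⁻ X, ‖f X‖ₑ ^ 2 ∂μ) ^ (1 / 2 : ℝ) * (∫⁻ X, ‖g X‖ₑ ^ 2 ∂μ) ^ (1 / 2 : ℝ)) ^ 2 := by
        gcongr
        exact h1.trans h2
    _ = (∫⁻ X, ‖f X‖ₑ ^ 2 ∂μ) * ∫⁻ X, ‖g X‖ₑ ^ 2 ∂μ := by
        rw [mul_pow, ← ENNReal.rpow_two, ← ENNReal.rpow_two, ← ENNReal.rpow_mul,
          ← ENNReal.rpow_mul]
        norm_num

/-! ### The mode weight `⟨n̂_k⟩_Φ / N` and the reduction -/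

/-- The **mode weight** `A_k(ψ) = ∫⁻_{cell^N} ‖ĉ_k‖₊²`, `ĉ_k = P₀(conj(e^{ik·x₀}) ψ)` (the `k`-mode
coefficient of particle `0` given the bath; the sibling line's `modeCoeff`), so that
`N · A_k(Φ) = ⟨Φ, n̂_k Φ⟩` for a Bose-symmetric `Φ`. -/
def modeWeight (m : ℕ) (L : ℝ) (n : Fin 3 → ℤ) (ψ : Config (m + 1) → ℂ) : ℝ≥0∞ :=
  ∫⁻ X in cellN (m + 1) L,
    (‖cellAvg (m + 1) L 0 (fun Y => conj (phase m L n Y) * ψ Y) X‖₊ : ℝ≥0∞) ^ 2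

/-- **R2 from one-mode softening (§B of the header).**  IF for the truncations `v_h = min(v,h)`, uniformly
in `h`, inside the density/momentum window, halving the dispersion of the single mode `k = 2πn/L` lowers
the ground-state energy by at most `C″` quanta `ρ∫v_h` — in variational form
`E₀(v_h) + ½k̃²·⟨n̂_k⟩_Φ ≤ E_{v_h}(Φ) + C″ρ∫v_h` for every periodic Bose trial state (`k̃ = 2π‖n‖∞/L`,
`⟨n̂_k⟩_Φ = N·modeWeight`) — THEN the body of `stub_healingChord` holds at `v` with the card's constant
`C = (2 + C″/K)/(4π²)`, on the whole half-line `s² ≥ K k̃²ρ∫v_h` (the anchor cap is not used).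
Mechanism: `Λ_k†Λ_k = n̂_k` exactly, so `2s|⟨Λ†⟩_Φ| = 2sN|I| ≤ 2s√⟨n̂_k⟩ ≤ ½k̃²⟨n̂_k⟩ + 2s²/k̃²`
(Cauchy–Schwarz `(N|I|)² ≤ (N∫|ĉ_k|²)(N∫|Θ|²)` with the landed Bose counting `stub_thetaNorm`), and
`C″ρ∫v_h ≤ (C″/K)s²/k̃²` on the window. [folklore] -/
theorem healingChord_of_modeSoftening (v : ℝ → ℝ≥0∞)
    (hsoft : ∀ M : ℝ, 0 < M → ∃ ρ₀ C'' : ℝ, 0 < ρ₀ ∧ 0 ≤ C'' ∧ ∃ N₀ : ℕ, ∀ h : ℝ, 0 < h →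
      ∀ m : ℕ, N₀ ≤ m + 1 → ∀ L : ℝ, 0 < L → ((m + 1 : ℕ) : ℝ) ≤ ρ₀ * L ^ 3 →
      ∀ n : Fin 3 → ℤ, n ≠ 0 → InWindow M m L n → ∀ Φ : PeriodicTrialState (m + 1) L,
        periodicGroundStateEnergy (fun r => min (v r) (ENNReal.ofReal h)) (m + 1) L +
            ENNReal.ofReal ((2 * Real.pi * ‖(fun j => (n j : ℝ))‖ / L) ^ 2 / 2 * ((m + 1 : ℕ) : ℝ)) *
              modeWeight m L n Φ.ψ ≤
          periodicEnergy (fun r => min (v r) (ENNReal.ofReal h)) Φ +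
            ENNReal.ofReal (C'' * ((((m + 1 : ℕ) : ℝ) / L ^ 3) *
              (∫⁻ x : Space, min (v ‖x‖) (ENNReal.ofReal h)).toReal))) :
    ∀ M : ℝ, 0 < M → ∀ K : ℝ, 0 < K →
      ∃ ρ₀ C : ℝ, 0 < ρ₀ ∧ 0 < C ∧ ∃ N₀ : ℕ, ∀ h : ℝ, 0 < h →
        ∀ m : ℕ, N₀ ≤ m + 1 → ∀ L : ℝ, 0 < L → ((m + 1 : ℕ) : ℝ) ≤ ρ₀ * L ^ 3 →
        ∀ n : Fin 3 → ℤ, n ≠ 0 → InWindow M m L n → ∀ s : ℝ, 0 ≤ s →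
          K * ((2 * Real.pi * ‖(fun j => (n j : ℝ))‖ / L) ^ 2 *
            (((m + 1 : ℕ) : ℝ) / L ^ 3) *
              (∫⁻ x : Space, min (v ‖x‖) (ENNReal.ofReal h)).toReal) ≤ s ^ 2 →
          s ^ 2 ≤ (2 * Real.pi * ‖(fun j => (n j : ℝ))‖ / L) ^ 2 *
            (periodicGroundStateEnergy (fun r => min (v r) (ENNReal.ofReal h)) (m + 1) L).toReal →
          ∀ Φ : PeriodicTrialState (m + 1) L,
            GDIneq (fun r => min (v r) (ENNReal.ofReal h)) m L n C s Φ := by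
  intro M hM K hK
  obtain ⟨ρ₀, C'', hρ₀, hC'', N₀, H⟩ := hsoft M hM
  refine ⟨ρ₀, (2 + C'' / K) / (4 * Real.pi ^ 2), hρ₀, by positivity, N₀, ?_⟩
  intro h hh m hm L hL hd n hn hw s hs hKs _hsA Φ
  have HΦ := H h hh m hm L hL hd n hn hw Φ
  -- names
  set w : ℝ → ℝ≥0∞ := fun r => min (v r) (ENNReal.ofReal h) with hw_def
  set nv : Fin 3 → ℝ := fun j => (n j : ℝ) with hnv
  set k2 : ℝ := (2 * Real.pi * ‖nv‖ / L) ^ 2 with hk2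
  set Nr : ℝ := ((m + 1 : ℕ) : ℝ) with hNr
  set V : ℝ := (∫⁻ x : Space, min (v ‖x‖) (ENNReal.ofReal h)).toReal with hV
  set P : ℝ := C'' * ((Nr / L ^ 3) * V) with hP
  set A : ℝ≥0∞ := modeWeight m L n Φ.ψ with hA
  set Bθ : ℝ≥0∞ := ∫⁻ X in cellN (m + 1) L, (‖theta m L Φ.ψ X‖₊ : ℝ≥0∞) ^ 2 with hBθ
  set I : ℂ := sourceIntegral m L n Φ.ψ with hI
  have hnvpos : 0 < ‖nv‖ := one_pos.trans_le (one_le_norm_intVec hn)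
  have hk2pos : 0 < k2 := by positivity
  have hNr1 : 1 ≤ Nr := by rw [hNr]; exact_mod_cast Nat.succ_le_succ (Nat.zero_le m)
  have hNrpos : 0 < Nr := lt_of_lt_of_le one_pos hNr1
  have hV0 : 0 ≤ V := ENNReal.toReal_nonneg
  have hP0 : 0 ≤ P := by positivity
  unfold GDIneq
  by_cases htop : periodicEnergy w Φ = ⊤
  · rw [htop, top_add]
    exact le_top
  have hE0le : periodicGroundStateEnergy w (m + 1) L ≤ periodicEnergy w Φ :=
    periodicGroundStateEnergy_le w Φ
  have hE0top : periodicGroundStateEnergy w (m + 1) L ≠ ⊤ := ne_top_of_le_ne_top htop hE0le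
  -- the mode weight is finite (from the softening bound and `E(Φ) < ⊤`)
  have hcoef : ENNReal.ofReal (k2 / 2 * Nr) ≠ 0 := by
    rw [ENNReal.ofReal_ne_zero_iff]
    positivity
  have hAtop : A ≠ ⊤ := by
    intro hAt
    have hAT : periodicGroundStateEnergy w (m + 1) L + ENNReal.ofReal (k2 / 2 * Nr) * A = ⊤ := by
      rw [hAt, ENNReal.mul_top hcoef, add_top]
    rw [hAT, top_le_iff, ENNReal.add_eq_top] at HΦ
    rcases HΦ with h1 | h1
    · exact htop h1
    · exact ENNReal.ofReal_ne_top h1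
  -- Bose counting (landed `stub_thetaNorm`): `N ∫|Θ|² ≤ 1`
  have hΘ : ((m + 1 : ℕ) : ℝ≥0∞) * Bθ ≤ 1 := stub_thetaNorm m L hL Φ
  have hBθtop : Bθ ≠ ⊤ := by
    refine ne_top_of_le_ne_top ENNReal.one_ne_top (le_trans ?_ hΘ)
    exact le_mul_of_one_le_left bot_le (by exact_mod_cast Nat.succ_le_succ (Nat.zero_le m))
  -- real shadows
  set a : ℝ := (periodicGroundStateEnergy w (m + 1) L).toReal with ha
  set e : ℝ := (periodicEnergy w Φ).toReal with he
  set α : ℝ := A.toReal with hα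
  set β : ℝ := Bθ.toReal with hβ
  have hα0 : 0 ≤ α := ENNReal.toReal_nonneg
  have hβ0 : 0 ≤ β := ENNReal.toReal_nonneg
  have hNβ : Nr * β ≤ 1 := by
    have h1 : ENNReal.ofReal (Nr * β) ≤ ENNReal.ofReal 1 := by
      rw [ENNReal.ofReal_mul hNrpos.le, hNr, ENNReal.ofReal_natCast, hβ,
        ENNReal.ofReal_toReal hBθtop, ENNReal.ofReal_one]
      exact hΘ
    exact (ENNReal.ofReal_le_ofReal_iff zero_le_one).mp h1
  -- Cauchy–Schwarz `(N|I|)² ≤ (N∫|ĉ_k|²)(N∫|Θ|²) ≤ N·α`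
  have hCS : ‖I‖ₑ ^ 2 ≤ A * Bθ := by
    rw [hI, sourceIntegral_eq_integral_conj_modeCoeff hL n Φ.contDiff.continuous]
    exact enorm_integral_conj_mul_sq_le
      (continuous_cellAvg 0 ((Complex.continuous_conj.comp (continuous_phase' m L n)).mul
        Φ.contDiff.continuous))
      (continuous_theta' m L Φ.contDiff.continuous)
  have hI2 : ‖I‖ ^ 2 ≤ α * β := by
    have h1 : ENNReal.ofReal (‖I‖ ^ 2) ≤ ENNReal.ofReal (α * β) := by
      rw [ENNReal.ofReal_pow (norm_nonneg _), ofReal_norm, ENNReal.ofReal_mul hα0, hα, hβ,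
        ENNReal.ofReal_toReal hAtop, ENNReal.ofReal_toReal hBθtop]
      exact hCS
    exact (ENNReal.ofReal_le_ofReal_iff (mul_nonneg hα0 hβ0)).mp h1
  have hx : (Nr * ‖I‖) ^ 2 ≤ Nr * α := by
    calc (Nr * ‖I‖) ^ 2 = Nr * (Nr * ‖I‖ ^ 2) := by ring
      _ ≤ Nr * (Nr * (α * β)) := by gcongr
      _ = (Nr * α) * (Nr * β) := by ring
      _ ≤ (Nr * α) * 1 := by gcongr
      _ = Nr * α := mul_one _
  -- the softening bound in reals: `a + ½k̃²·Nα ≤ e + P`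
  have hsoftR : a + k2 / 2 * (Nr * α) ≤ e + P := by
    have h1 := HΦ
    rw [← ENNReal.ofReal_toReal hE0top, ← ENNReal.ofReal_toReal htop,
      ← ENNReal.ofReal_toReal hAtop] at h1
    change ENNReal.ofReal a + ENNReal.ofReal (k2 / 2 * Nr) * ENNReal.ofReal α ≤
      ENNReal.ofReal e + ENNReal.ofReal P at h1
    rw [← ENNReal.ofReal_mul (by positivity), ← ENNReal.ofReal_add ENNReal.toReal_nonneg
      (by positivity), ← ENNReal.ofReal_add ENNReal.toReal_nonneg hP0,
      ENNReal.ofReal_le_ofReal_iff (by positivity)] at h1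
    linarith [h1]
  -- the window: `P = C″ρ∫v_h ≤ C″ s²/(K k̃²)`
  have hPle : P ≤ C'' * (s ^ 2 / (K * k2)) := by
    have h2 : (Nr / L ^ 3) * V ≤ s ^ 2 / (K * k2) := by
      rw [le_div_iff₀ (mul_pos hK hk2pos)]
      calc Nr / L ^ 3 * V * (K * k2) = K * (k2 * (Nr / L ^ 3) * V) := by ring
        _ ≤ s ^ 2 := hKs
    exact mul_le_mul_of_nonneg_left h2 hC''
  -- pass to reals in the goal
  have hpen : 0 ≤ (2 + C'' / K) / (4 * Real.pi ^ 2) * s ^ 2 * L ^ 2 / ‖nv‖ ^ 2 := by positivity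
  have hsrc : 0 ≤ s * (2 * (m + 1) * ‖I‖) := by positivity
  rw [← ENNReal.ofReal_toReal hE0top, ← ENNReal.ofReal_toReal htop,
    ← ENNReal.ofReal_add ENNReal.toReal_nonneg hsrc,
    ← ENNReal.ofReal_add ENNReal.toReal_nonneg hpen,
    ENNReal.ofReal_le_ofReal_iff (add_nonneg ENNReal.toReal_nonneg hpen)]
  change a + s * (2 * (m + 1) * ‖I‖) ≤ e + (2 + C'' / K) / (4 * Real.pi ^ 2) * s ^ 2 * L ^ 2 / ‖nv‖ ^ 2
  have hNr' : ((m : ℝ) + 1) = Nr := by rw [hNr]; push_cast; ring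
  have hLne : L ≠ 0 := hL.ne'
  have hKne : K ≠ 0 := hK.ne'
  have hnvne : ‖nv‖ ≠ 0 := hnvpos.ne'
  have hkey : (2 + C'' / K) / (4 * Real.pi ^ 2) * s ^ 2 * L ^ 2 / ‖nv‖ ^ 2 =
      2 * (s ^ 2 / k2) + C'' * (s ^ 2 / (K * k2)) := by
    rw [hk2]
    field_simp
    ring
  rw [hNr', hkey]
  -- AM–GM: `2s·(N|I|) ≤ ½k̃²(N|I|)² + 2s²/k̃² ≤ ½k̃²·Nα + 2s²/k̃²`
  have hamgm : s * (2 * Nr * ‖I‖) ≤ k2 / 2 * (Nr * α) + 2 * (s ^ 2 / k2) := by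
    set x : ℝ := Nr * ‖I‖ with hx_def
    have h1 : s * (2 * x) * (2 * k2) ≤ k2 ^ 2 * x ^ 2 + 4 * s ^ 2 := by
      nlinarith [sq_nonneg (k2 * x - 2 * s)]
    have h2 : s * (2 * x) ≤ k2 / 2 * x ^ 2 + 2 * (s ^ 2 / k2) := by
      rw [show k2 / 2 * x ^ 2 + 2 * (s ^ 2 / k2) = (k2 ^ 2 * x ^ 2 + 4 * s ^ 2) / (2 * k2) by
        field_simp; ring]
      rw [le_div_iff₀ (by positivity)]
      exact h1
    calc s * (2 * Nr * ‖I‖) = s * (2 * x) := by rw [hx_def]; ring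
      _ ≤ k2 / 2 * x ^ 2 + 2 * (s ^ 2 / k2) := h2
      _ ≤ k2 / 2 * (Nr * α) + 2 * (s ^ 2 / k2) := by gcongr
  linarith [hamgm, hsoftR, hPle]

/-- **What (*) says about the ground state** (the infrared-bound reading of §B): at a `δ`-near-minimiser
the softening bound is an OCCUPATION bound for the mode `k`, `½k̃²·⟨n̂_k⟩_Φ ≤ δ + C″ρ∫v_h` — i.e.
`n_k(Ψ₀) ≤ 2C″ρ∫v_h/k̃²`, uniformly as `L → ∞` at fixed density. [folklore] -/
theorem modeWeight_le_of_softening {w : ℝ → ℝ≥0∞} {m : ℕ} {L : ℝ} {n : Fin 3 → ℤ} {c P : ℝ}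
    {δ : ℝ≥0∞} (Φ : PeriodicTrialState (m + 1) L)
    (hsoft : periodicGroundStateEnergy w (m + 1) L + ENNReal.ofReal c * modeWeight m L n Φ.ψ ≤
      periodicEnergy w Φ + ENNReal.ofReal P)
    (hnear : periodicEnergy w Φ ≤ periodicGroundStateEnergy w (m + 1) L + δ)
    (htop : periodicGroundStateEnergy w (m + 1) L ≠ ⊤) :
    ENNReal.ofReal c * modeWeight m L n Φ.ψ ≤ δ + ENNReal.ofReal P := by
  have h : periodicGroundStateEnergy w (m + 1) L + ENNReal.ofReal c * modeWeight m L n Φ.ψ ≤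
      periodicGroundStateEnergy w (m + 1) L + (δ + ENNReal.ofReal P) := by
    calc _ ≤ periodicEnergy w Φ + ENNReal.ofReal P := hsoft
      _ ≤ periodicGroundStateEnergy w (m + 1) L + δ + ENNReal.ofReal P := add_le_add hnear le_rfl
      _ = _ := add_assoc _ _ _
  exact (ENNReal.add_le_add_iff_left htop).mp h

/-- **Certificate**: the reduction targets EXACTLY the registered signature of `stub_healingChord` — a
one-mode softening bound for every admissible `v` (uniform over its truncations) implies the stub verbatim. -/
example
    (hsoft : ∀ v : ℝ → ℝ≥0∞, IsRepulsiveFiniteRange v →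
      ∀ M : ℝ, 0 < M → ∃ ρ₀ C'' : ℝ, 0 < ρ₀ ∧ 0 ≤ C'' ∧ ∃ N₀ : ℕ, ∀ h : ℝ, 0 < h →
      ∀ m : ℕ, N₀ ≤ m + 1 → ∀ L : ℝ, 0 < L → ((m + 1 : ℕ) : ℝ) ≤ ρ₀ * L ^ 3 →
      ∀ n : Fin 3 → ℤ, n ≠ 0 → InWindow M m L n → ∀ Φ : PeriodicTrialState (m + 1) L,
        periodicGroundStateEnergy (fun r => min (v r) (ENNReal.ofReal h)) (m + 1) L +
            ENNReal.ofReal ((2 * Real.pi * ‖(fun j => (n j : ℝ))‖ / L) ^ 2 / 2 * ((m + 1 : ℕ) : ℝ)) *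
              modeWeight m L n Φ.ψ ≤
          periodicEnergy (fun r => min (v r) (ENNReal.ofReal h)) Φ +
            ENNReal.ofReal (C'' * ((((m + 1 : ℕ) : ℝ) / L ^ 3) *
              (∫⁻ x : Space, min (v ‖x‖) (ENNReal.ofReal h)).toReal))) :
    ∀ v : ℝ → ℝ≥0∞, IsRepulsiveFiniteRange v → ∀ M : ℝ, 0 < M → ∀ K : ℝ, 0 < K → ∃ ρ₀ C : ℝ, 0 < ρ₀ ∧ 0 < C ∧ ∃ N₀ : ℕ, ∀ h : ℝ, 0 < h → ∀ m : ℕ, N₀ ≤ m + 1 → ∀ L : ℝ, 0 < L → ((m + 1 : ℕ) : ℝ) ≤ ρ₀ * L ^ 3 → ∀ n : Fin 3 → ℤ, n ≠ 0 → InWindow M m L n → ∀ s : ℝ, 0 ≤ s → K * ((2 * Real.pi * ‖(fun j => (n j : ℝ))‖ / L) ^ 2 * (((m + 1 : ℕ) : ℝ) / L ^ 3) * (∫⁻ x : Space, min (v ‖x‖) (ENNReal.ofReal h)).toReal) ≤ s ^ 2 → s ^ 2 ≤ (2 * Real.pi * ‖(fun j => (n j : ℝ))‖ / L) ^ 2 *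 (periodicGroundStateEnergy (fun r => min (v r) (ENNReal.ofReal h)) (m + 1) L).toReal → ∀ Φ : PeriodicTrialState (m + 1) L, GDIneq (fun r => min (v r) (ENNReal.ofReal h)) m L n C s Φ :=
  fun v hv => healingChord_of_modeSoftening v (hsoft v hv)

/-- **Certificate**: `healingChord_zero` is the registered signature's body at `v = 0`. -/
example : (fun v : ℝ → ℝ≥0∞ => (∀ M : ℝ, 0 < M → ∀ K : ℝ, 0 < K → ∃ ρ₀ C : ℝ, 0 < ρ₀ ∧ 0 < C ∧ ∃ N₀ : ℕ, ∀ h : ℝ, 0 < h → ∀ m : ℕ, N₀ ≤ m + 1 → ∀ L : ℝ, 0 < L → ((m + 1 : ℕ) : ℝ) ≤ ρ₀ * L ^ 3 → ∀ n : Fin 3 → ℤ, n ≠ 0 → InWindow M m L n → ∀ s : ℝ, 0 ≤ s → K * ((2 * Real.pi * ‖(fun j => (n j : ℝ))‖ / L) ^ 2 * (((m + 1 : ℕ) : ℝ) / L ^ 3) * (∫⁻ x : Space, min (v ‖x‖) (ENNReal.ofReal h)).toReal) ≤ s ^ 2 → s ^ 2 ≤ (2 * Real.pi * ‖(fun j =>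 (n j : ℝ))‖ / L) ^ 2 * (periodicGroundStateEnergy (fun r => min (v r) (ENNReal.ofReal h)) (m + 1) L).toReal → ∀ Φ : PeriodicTrialState (m + 1) L, GDIneq (fun r => min (v r) (ENNReal.ofReal h)) m L n C s Φ)) 0 :=
  healingChord_zero

end Reduction

end HealingChord

end Summit.AtomisticToContinuum.BoseEinsteinCondensation.Cruxes.GaussianDominationCan.RamanChordRegimes

end
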